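import Summits.QuantumFields.BalabanUV.Beta.RemainderExplicitEnd
import Summits.QuantumFields.BalabanUV.Beta.RemainderExplicitWitness

/-!
# Beta / RemainderExplicitEndWitness — BINDER-OWNERS row D4, ROAD P3 (co-owner #3, unit `b2b-balaban-beta-d4-p3`): NON-VACUITY OF THE
# END WITH (E),(V) DISCHARGED — the hypotheses of `RemainderExplicitEnd.exists_remainderConst_of_residualChain` are JOINTLY INHABITED
# relative to the EXPLICIT carrier family (trivial densities over the constructed carrier), and the END fires on the witness

HONEST FRAMING (page 1 of everything the β sub-cell writes): discharging `BetaPertH` makes Bałaban's UV stability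
UNCONDITIONAL — a real constructive-QFT result; it is NOT the continuum limit and NOT the Clay problem.  HONEST DEPENDENCY
(verbatim): «continuum YM on T⁴ ⇐ BetaPertH ∧ nine spine estimates (0/9 proved); BetaPertH ⇐ (D1) ∧ (D4) ∧ CAP+tail;
G-an2-4 gates asym, D1 and NE2/3/4.»  NOT IN PRINT; OUR BOOKKEEPING.  `[folklore]`: the row owner's zero-activity torus steps and
witness constants (`Beta.RemainderWitness.zeroStep`, `c₀`, `splitZero`) placed over road P3's CONSTRUCTED carrier `carrierBal`; the only new
point relative to `RemainderExplicitWitness` (gen 1, abstract zero carrier) is that the residual is now inhabited RELATIVE TO THE EXPLICIT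
CARRIER and that the chain's rate can be chosen below the carrier's rate `δ₀⋆`.  A sanity certificate (the END is not vacuously true), nothing
more: the witness densities are trivial, not Bałaban's.  No cited fact; NOT summit progress.

ABSOLUTE RULE (cell charter, verbatim): "No internally-minted statement may enter as a cited fact. Every hypothesis is
either kernel-proved in this package or a verbatim quotation of a PUBLISHED theorem with page reference. The manuscript(s)
under audit are NOT citable for their own disputed steps — they are the thing under adjudication; programme-internal
(2001/route/tribunal) claims are never citable."
-/

noncomputable section

open Filter Topology
open Literature.MathematicalPhysics.QuantumFieldTheory.Balaban1983to89
open Literature.MathematicalPhysics.QuantumFieldTheory.Balaban1983to89.Beta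
open Beta.RemainderChain (RemainderConst)
open Beta.RemainderChainLattice (CondsL remCoeffL)
open Beta.RemainderLimitTorus (LDom)
open Beta.RemainderWitness (c₀ splitZero zeroStep zeroStep_spRestr zeroStep_repr213 zeroStep_bound238With mixedDeriv_zero
  c₀_condsL c₀_R22gen c₀_activity_pos)
open Summit.QuantumFields.BalabanUV.Beta.RemainderExplicitRoad (ExplicitCarrier Residual ResidualChain)
open Summit.QuantumFields.BalabanUV.Beta.RemainderExplicitCarrier (carrierBal)
open Summit.QuantumFields.BalabanUV.Beta.RemainderExplicitEnd (carrierFamily exists_remainderConst_of_residualChain)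

namespace Summit.QuantumFields.BalabanUV.Beta.RemainderExplicitEndWitness

variable (Lc : ℕ) [NeZero Lc] (Mc : ℕ) [NeZero Mc] (Nn : ℕ → ℕ) [∀ n, NeZero (Nn n)]

/-! ## §1 Witness constants with an adjustable decay rate -/

/-- The row owner's witness constants `c₀ 4` with the decay rate replaced by `δ` (the four numeric conditions, the closing relation and
the activity do not involve `δ₀`). [folklore] -/
def cδ (δ : ℝ) : B13.Consts := { c₀ 4 with δ₀ := δ }

/-- [folklore] `CondsL 4 (cδ δ) 2` (the conditions read `κ, δ, ε₁, C₃, A₂` only). -/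
theorem cδ_condsL (δ : ℝ) : CondsL 4 (cδ δ) 2 :=
  ⟨(c₀_condsL 4).large, (c₀_condsL 4).small, (c₀_condsL 4).A₂, (c₀_condsL 4).tree⟩

/-- [folklore] The closing relation `(1 − 10δ)·2 = 1`. -/
theorem cδ_R22gen (δ : ℝ) : (cδ δ).R22gen 2 := c₀_R22gen 4

/-- [folklore] The activity is nonnegative (indeed positive). -/
theorem cδ_activity_nonneg (δ : ℝ) : 0 ≤ (cδ δ).C3act * (cδ δ).ε₁ := (c₀_activity_pos 4).le

/-- [folklore] The rate field. -/
@[simp] theorem cδ_δ₀ (δ : ℝ) : (cδ δ).δ₀ = δ := rfl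

/-! ## §2 The zero residual RELATIVE TO THE EXPLICIT CARRIER -/

/-- **THE ZERO RESIDUAL OVER `carrierBal`** (trivial densities: zero-activity torus steps, `𝐄 ≡ 0`, `F ≡ 0`), for any constants with
`0 ≤ C₃ε₁`. [folklore] -/
def zeroResidualBal (j : ℕ) (hN : Tendsto Nn atTop atTop) (μ ν : Fin 4) (c : B13.Consts) (ℓ α₂ : ℝ) (hA : 0 ≤ c.C3act * c.ε₁) :
    Residual (carrierBal Lc j Mc Nn hN μ ν) (fun (_ : LDom 4) (_ : B13ScaleTransfer.Pt 4) => (0 : ℝ)) c ℓ α₂ where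
  W := fun n => zeroStep 4 (Nn n)
  hsp := fun n => zeroStep_spRestr 4 (Nn n)
  hrep := fun n => zeroStep_repr213 4 (Nn n)
  h238 := fun n => zeroStep_bound238With 4 (Nn n) c ℓ hA
  EXn := fun _ _ _ => 0
  emb := fun _ _ _ => ()
  hemb := fun _ _ _ _ => Set.mem_univ _
  hcomp := fun _ _ _ => rfl
  E2n := fun _ _ _ _ => 0
  han := fun _ _ => analyticOnNhd_const
  hrepr := fun _ _ _ _ => by rw [mixedDeriv_zero]; simp
  F := fun _ _ => 0
  hF := fun _ => analyticAt_const
  hfac := fun _ => Eventually.of_forall fun _ _ _ => by simp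
  ha := fun _ _ => by rw [mixedDeriv_zero]; simp

/-- **THE ZERO RESIDUAL CHAIN OVER THE EXPLICIT CARRIER FAMILY** for the split `splitZero`. [folklore] -/
def zeroResidualChainBal (hN : Tendsto Nn atTop atTop) (μ ν : Fin 4) (γ : ℝ) (c : B13.Consts) (ℓ α₂ : ℝ)
    (hA : 0 ≤ c.C3act * c.ε₁) : ResidualChain 4 Mc μ ν splitZero γ c ℓ α₂ (carrierFamily Lc Mc Nn hN μ ν) where
  A1 := fun _ _ _ _ => 0
  beta1_eq := fun _ _ _ => by
    show (0 : ℝ) = B12Beta.secondMoment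
      (fun _ _ => RemainderLimitTorus.limKernel (fun (_ : LDom 4) (_ : B13ScaleTransfer.Pt 4) => (0 : ℝ))) μ ν
    simp [B12Beta.secondMoment, RemainderLimitTorus.limKernel]
  res := fun k _ _ => zeroResidualBal Lc Mc Nn k hN μ ν c ℓ α₂ hA

/-! ## §3 Joint inhabitation of the END's hypotheses, and the END applied -/

/-- [folklore] **THE HYPOTHESES OF `exists_remainderConst_of_residualChain` ARE JOINTLY INHABITED**: with the END's own constants
`(δ₀⋆, B₃)` there are a split, constants `c` (the owner's witness constants with rate `δ₀⋆`), `ℓ = 2`, `α₂ = 1` and a residual chain RELATIVE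
TO THE EXPLICIT CARRIER FAMILY satisfying every hypothesis — and the END then yields its conclusion. -/
theorem end_inhabited_and_applied (hN : Tendsto Nn atTop atTop) (μ ν : Fin 4) (γ : ℝ) :
    ∃ δ₀ B₃ : ℝ, 0 < δ₀ ∧ 0 ≤ B₃ ∧
      Nonempty (ResidualChain 4 Mc μ ν splitZero γ (cδ δ₀) 2 1 (carrierFamily Lc Mc Nn hN μ ν)) ∧
      CondsL 4 (cδ δ₀) 2 ∧ (cδ δ₀).R22gen 2 ∧ 0 ≤ (cδ δ₀).C3act * (cδ δ₀).ε₁ ∧ 0 < (cδ δ₀).δ₀ ∧ (cδ δ₀).δ₀ ≤ δ₀ ∧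
      RemainderConst splitZero γ ((cδ δ₀).ε₁ * remCoeffL 4 Mc (cδ δ₀) 1 B₃) := by
  obtain ⟨δ₀, B₃, hδ, hB, hEND⟩ := exists_remainderConst_of_residualChain Lc Mc Nn hN μ ν
  refine ⟨δ₀, B₃, hδ, hB, ⟨zeroResidualChainBal Lc Mc Nn hN μ ν γ (cδ δ₀) 2 1 (cδ_activity_nonneg δ₀)⟩, cδ_condsL δ₀,
    cδ_R22gen δ₀, cδ_activity_nonneg δ₀, by simpa using hδ, by simp, ?_⟩
  exact hEND (zeroResidualChainBal Lc Mc Nn hN μ ν γ (cδ δ₀) 2 1 (cδ_activity_nonneg δ₀)) (cδ_condsL δ₀) (cδ_R22gen δ₀)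
    (cδ_activity_nonneg δ₀) one_pos (by simpa using hδ) (by simp)

end Summit.QuantumFields.BalabanUV.Beta.RemainderExplicitEndWitness

end
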